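import Mathlib
import Summits.Ventures.HodgeRepro2.T5PadicOpenSubgroups

/-!
# T5PadicFiniteOrderCharacters — finite-order continuous characters of `ℤ_p`: p-power order, `Ξ ≃ μ_{p^∞}`,
and the injection `ν ↦ ν(γ₀) − 1` into the open unit disc

Cell pub-hodge-repro2, Tier 5 support (seat p7; route/T5-CHECK-G-p7.md §3 S5 / S8). The two sentences
of §G's chain on the group `Γ_𝔭 ≅ ℤ_p` (generator `γ₀ ↦ 1`):

* S8 «ν ∈ Ξ_𝔭 (finite order, p-power order since Γ_𝔭 ≅ ℤ_p)»: a continuous character `κ` of `ℤ_p`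
  with finitely many values has OPEN kernel (`isOpen_ker`), hence kernel `p^k ℤ_p`
  (`exists_ker_eq_span_pow`, T5PadicOpenSubgroups) and `κ^{p^k} = 1` (`exists_pow_eq_one_of_finite_range`);
  the order of `κ 1` is exactly the index `p^k` of the kernel (`exists_ker_eq_span_pow_and_orderOf`);
* S5 «ν ∈ Ξ_𝔭 with ν(γ₀) = ζ ∈ μ_{p^∞}; ν ↦ ζ_ν − 1 is injective into the open disc»: a continuous
  character is determined by its value at `1` (`eq_of_eval_one_eq`, density of `ℕ` in `ℤ_p`); every
  `ζ` with `ζ^{p^k} = 1` is the value at `1` of the continuous character `x ↦ ζ^{(x mod p^k)}`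
  (`ofRootOfUnity`); so the finite-order continuous characters of `ℤ_p` ARE the p-power roots of unity
  (`finiteOrderCharEquiv`, `finiteRangeCharEquiv`); and for a normed ultrametric `ℤ_p`-algebra
  `ν ↦ ν(1) − 1` is injective (`eval_one_sub_one_injective`) with image in the open unit disc
  (`norm_eval_one_sub_one_lt_one`, Mathlib's `AddChar.tendsto_eval_one_sub_pow`). In particular every
  p-power root of unity `ζ` of such an algebra satisfies `‖ζ − 1‖ < 1` (`norm_sub_one_lt_one`) and
  `ζ − 1` is a legitimate evaluation point of power series (`hasEval_sub_one_of_pow_eq_one` — the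
  hypothesis `HasEval` of p8's T5FiniteZeros).

Mathlib + T5PadicOpenSubgroups only; nothing about L-functions or measures is asserted.
-/

namespace Summit.Ventures.HodgeRepro2.T5PadicFiniteOrderCharacters

open PadicInt Filter Topology Metric
open Summit.Ventures.HodgeRepro2.T5PadicOpenSubgroups

variable {p : ℕ} [hp : Fact p.Prime]

section Monoid

variable {R : Type*} [Monoid R] [TopologicalSpace R]

/-- The kernel `{x : κ x = 1}` of an additive character `κ : ℤ_p → R`, as an additive subgroup. -/
def kerAddSubgroup (κ : AddChar ℤ_[p] R) : AddSubgroup ℤ_[p] where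
  carrier := {x | κ x = 1}
  add_mem' := by
    intro a b ha hb
    simp only [Set.mem_setOf_eq] at ha hb ⊢
    rw [AddChar.map_add_eq_mul, ha, hb, one_mul]
  zero_mem' := AddChar.map_zero_eq_one κ
  neg_mem' := by
    intro a ha
    simp only [Set.mem_setOf_eq] at ha ⊢
    have h := κ.map_add_eq_mul (-a) a
    rw [neg_add_cancel, AddChar.map_zero_eq_one, ha, mul_one] at h
    exact h.symm

omit [TopologicalSpace R] in
/-- Membership in the kernel. -/
@[simp] theorem mem_kerAddSubgroup (κ : AddChar ℤ_[p] R) (x : ℤ_[p]) :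
    x ∈ kerAddSubgroup κ ↔ κ x = 1 := Iff.rfl

/-- A continuous character with finitely many values has OPEN kernel: the finitely many values
`≠ 1` form a closed set (T1), and the kernel is the preimage of its complement. -/
theorem isOpen_ker [T1Space R] (κ : AddChar ℤ_[p] R) (hκ : Continuous κ)
    (hfin : (Set.range κ).Finite) : IsOpen ((kerAddSubgroup κ : Set ℤ_[p])) := by
  have hS : IsClosed (Set.range κ \ {1}) := (hfin.sdiff).isClosed
  have hpre : (kerAddSubgroup κ : Set ℤ_[p]) = κ ⁻¹' (Set.range κ \ {1})ᶜ := by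
    ext x
    simp only [SetLike.mem_coe, mem_kerAddSubgroup, Set.preimage_compl, Set.mem_compl_iff,
      Set.mem_preimage, Set.mem_sdiff, Set.mem_range, exists_apply_eq_apply, true_and,
      Set.mem_singleton_iff, not_not]
  rw [hpre]
  exact hS.isOpen_compl.preimage hκ

/-- The kernel of a continuous finite-range character of `ℤ_p` is `p^k ℤ_p` for some `k`. -/
theorem exists_ker_eq_span_pow [T1Space R] (κ : AddChar ℤ_[p] R) (hκ : Continuous κ)
    (hfin : (Set.range κ).Finite) :
    ∃ k : ℕ, kerAddSubgroup κ = (Ideal.span {(p : ℤ_[p]) ^ k}).toAddSubgroup :=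
  eq_span_pow_of_isOpen _ (isOpen_ker κ hκ hfin)

omit [TopologicalSpace R] in
/-- `κ (p^k * x) = κ x ^ (p^k)`. -/
theorem map_pow_mul (κ : AddChar ℤ_[p] R) (k : ℕ) (x : ℤ_[p]) :
    κ ((p : ℤ_[p]) ^ k * x) = κ x ^ (p ^ k) := by
  rw [← AddChar.map_nsmul_eq_pow, nsmul_eq_mul, Nat.cast_pow]

/-- S8, «p-power order»: a continuous character of `ℤ_p` with finitely many values satisfies
`κ^{p^k} = 1` for some `k` (its open kernel contains `p^k ℤ_p`). -/
theorem exists_pow_eq_one_of_finite_range [T1Space R] (κ : AddChar ℤ_[p] R) (hκ : Continuous κ)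
    (hfin : (Set.range κ).Finite) : ∃ k : ℕ, ∀ x : ℤ_[p], κ x ^ (p ^ k) = 1 := by
  obtain ⟨k, hk⟩ := exists_forall_pow_mul_mem_of_isOpen _ (isOpen_ker κ hκ hfin)
  refine ⟨k, fun x => ?_⟩
  rw [← map_pow_mul]
  exact hk x

/-- `p^j ∉ p^k ℤ_p` for `j < k`. -/
theorem pow_not_mem_span_pow {j k : ℕ} (hjk : j < k) :
    (p : ℤ_[p]) ^ j ∉ (Ideal.span {(p : ℤ_[p]) ^ k}).toAddSubgroup := by
  rw [Submodule.mem_toAddSubgroup, ← norm_le_pow_iff_mem_span_pow, norm_p_pow, not_le]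
  have hp1 : (1 : ℝ) < (p : ℝ) := by exact_mod_cast hp.out.one_lt
  exact zpow_lt_zpow_right₀ hp1 (by omega)

omit [TopologicalSpace R] in
/-- The order of `κ 1` is exactly the index of the kernel: if `ker κ = p^k ℤ_p` then
`orderOf (κ 1) = p^k` (`κ 1 ^ p^k = κ (p^k) = 1`, and `κ 1 ^ p^{k-1} = κ (p^{k-1}) ≠ 1`). -/
theorem orderOf_eval_one_of_ker_eq (κ : AddChar ℤ_[p] R) (k : ℕ)
    (hker : kerAddSubgroup κ = (Ideal.span {(p : ℤ_[p]) ^ k}).toAddSubgroup) :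
    orderOf (κ 1) = p ^ k := by
  have hpow : ∀ j : ℕ, κ 1 ^ (p ^ j) = κ ((p : ℤ_[p]) ^ j) := by
    intro j
    rw [← map_pow_mul, mul_one]
  rcases k with _ | k
  · -- the kernel is everything: `κ = 1`
    have h1 : κ 1 = 1 := by
      have : (1 : ℤ_[p]) ∈ kerAddSubgroup κ := by
        rw [hker, Submodule.mem_toAddSubgroup, pow_zero, Ideal.span_singleton_one]
        exact Submodule.mem_top
      exact this
    rw [h1, orderOf_one, pow_zero]
  · apply orderOf_eq_prime_pow
    · rw [hpow]
      intro h
      have : (p : ℤ_[p]) ^ k ∈ kerAddSubgroup κ := h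
      rw [hker] at this
      exact pow_not_mem_span_pow (Nat.lt_succ_self k) this
    · rw [hpow]
      have : (p : ℤ_[p]) ^ (k + 1) ∈ kerAddSubgroup κ := by
        rw [hker, Submodule.mem_toAddSubgroup]
        exact Ideal.mem_span_singleton_self _
      exact this

/-- S8 in full: for a continuous finite-range character `κ` of `ℤ_p` there is a unique `k` with
`ker κ = p^k ℤ_p`, and then `κ 1` has order exactly `p^k` and `κ^{p^k} = 1`. -/
theorem exists_ker_eq_span_pow_and_orderOf [T1Space R] (κ : AddChar ℤ_[p] R) (hκ : Continuous κ)
    (hfin : (Set.range κ).Finite) :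
    ∃ k : ℕ, kerAddSubgroup κ = (Ideal.span {(p : ℤ_[p]) ^ k}).toAddSubgroup ∧
      orderOf (κ 1) = p ^ k ∧ ∀ x : ℤ_[p], κ x ^ (p ^ k) = 1 := by
  obtain ⟨k, hk⟩ := exists_ker_eq_span_pow κ hκ hfin
  refine ⟨k, hk, orderOf_eval_one_of_ker_eq κ k hk, fun x => ?_⟩
  rw [← map_pow_mul]
  have : (p : ℤ_[p]) ^ k * x ∈ kerAddSubgroup κ := by
    rw [hk, Submodule.mem_toAddSubgroup]
    exact Ideal.mul_mem_right _ _ (Ideal.mem_span_singleton_self _)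
  exact this

/-- A continuous character of `ℤ_p` is determined by its value at `1` (`ℕ` is dense in `ℤ_p`;
Mathlib's `DenseRange.addChar_eq_of_eval_one_eq`). -/
theorem eq_of_eval_one_eq [T2Space R] {κ₁ κ₂ : AddChar ℤ_[p] R} (hκ₁ : Continuous κ₁)
    (hκ₂ : Continuous κ₂) (h : κ₁ 1 = κ₂ 1) : κ₁ = κ₂ :=
  denseRange_natCast.addChar_eq_of_eval_one_eq hκ₁ hκ₂ h

/-- `κ ↦ κ 1` is injective on continuous characters of `ℤ_p`. -/
theorem eval_one_injective [T2Space R] :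
    Function.Injective (fun κ : {κ : AddChar ℤ_[p] R // Continuous κ} => κ.1 1) := by
  intro κ₁ κ₂ h
  exact Subtype.ext (eq_of_eval_one_eq κ₁.2 κ₂.2 h)

/-- `x ↦ x mod p^k` is locally constant on `ℤ_p` (constant on the open balls `x + p^k ℤ_p`). -/
theorem isLocallyConstant_toZModPow (k : ℕ) :
    IsLocallyConstant (toZModPow k : ℤ_[p] → ZMod (p ^ k)) := by
  rw [IsLocallyConstant.iff_exists_open]
  intro x
  refine ⟨closedBall x ((p : ℝ) ^ (-(k : ℤ))), IsUltrametricDist.isOpen_closedBall _ ?_,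
    mem_closedBall_self (by positivity), fun y hy => ?_⟩
  · have : (0 : ℝ) < (p : ℝ) ^ (-(k : ℤ)) := by
      have := hp.out.pos
      positivity
    exact this.ne'
  · rw [mem_closedBall, dist_eq_norm, norm_le_pow_iff_mem_span_pow, ← ker_toZModPow,
      RingHom.mem_ker, map_sub, sub_eq_zero] at hy
    exact hy

/-- The continuous character `x ↦ ζ^{(x mod p^k)}` of `ℤ_p` attached to a root of unity
`ζ` with `ζ^{p^k} = 1`: the character «ν with ν(γ₀) = ζ» of S5. -/
noncomputable def ofRootOfUnity (ζ : R) (k : ℕ) (hζ : ζ ^ (p ^ k) = 1) : AddChar ℤ_[p] R where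
  toFun x := ζ ^ (toZModPow k x).val
  map_zero_eq_one' := by
    rw [map_zero, ZMod.val_zero, pow_zero]
  map_add_eq_mul' a b := by
    rw [map_add, ZMod.val_add, ← pow_add]
    exact (pow_eq_pow_mod _ hζ).symm

omit [TopologicalSpace R] in
/-- The defining formula of `ofRootOfUnity`. -/
theorem ofRootOfUnity_apply (ζ : R) (k : ℕ) (hζ : ζ ^ (p ^ k) = 1) (x : ℤ_[p]) :
    ofRootOfUnity ζ k hζ x = ζ ^ (toZModPow k x).val := rfl

omit [TopologicalSpace R] in
/-- `ofRootOfUnity ζ k hζ` takes the value `ζ` at `1` (for `k = 0` both sides are `1`). -/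
theorem ofRootOfUnity_apply_one (ζ : R) (k : ℕ) (hζ : ζ ^ (p ^ k) = 1) :
    ofRootOfUnity ζ k hζ 1 = ζ := by
  rw [ofRootOfUnity_apply, map_one, ZMod.val_one_eq_one_mod, ← pow_eq_pow_mod 1 hζ, pow_one]

omit [TopologicalSpace R] in
/-- Every value of `ofRootOfUnity ζ k hζ` is a `p^k`-th root of unity. -/
theorem ofRootOfUnity_pow (ζ : R) (k : ℕ) (hζ : ζ ^ (p ^ k) = 1) (x : ℤ_[p]) :
    ofRootOfUnity ζ k hζ x ^ (p ^ k) = 1 := by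
  rw [ofRootOfUnity_apply, ← pow_mul, mul_comm, pow_mul, hζ, one_pow]

/-- `ofRootOfUnity ζ k hζ` is continuous (it factors through the locally constant `x ↦ x mod p^k`). -/
theorem continuous_ofRootOfUnity (ζ : R) (k : ℕ) (hζ : ζ ^ (p ^ k) = 1) :
    Continuous (ofRootOfUnity ζ k hζ) :=
  ((isLocallyConstant_toZModPow k).comp fun a : ZMod (p ^ k) => ζ ^ a.val).continuous

omit [TopologicalSpace R] in
/-- `ofRootOfUnity ζ k hζ` has finitely many values (it factors through the finite `ℤ/p^kℤ`). -/
theorem finite_range_ofRootOfUnity (ζ : R) (k : ℕ) (hζ : ζ ^ (p ^ k) = 1) :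
    (Set.range (ofRootOfUnity ζ k hζ)).Finite :=
  (Set.finite_range fun a : ZMod (p ^ k) => ζ ^ a.val).subset
    (Set.range_comp_subset_range (toZModPow k) fun a : ZMod (p ^ k) => ζ ^ a.val)

/-- S5, «ν ∈ Ξ_𝔭 with ν(γ₀) = ζ ∈ μ_{p^∞}»: the continuous characters of `ℤ_p` of p-power order
correspond bijectively, via `ν ↦ ν(1)`, to the p-power roots of unity of `R`. -/
noncomputable def finiteOrderCharEquiv [T2Space R] :
    {κ : AddChar ℤ_[p] R // Continuous κ ∧ ∃ k : ℕ, ∀ x : ℤ_[p], κ x ^ (p ^ k) = 1} ≃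
      {ζ : R // ∃ k : ℕ, ζ ^ (p ^ k) = 1} where
  toFun κ := ⟨κ.1 1, κ.2.2.imp fun _ h => h 1⟩
  invFun ζ := ⟨ofRootOfUnity ζ.1 (Classical.choose ζ.2) (Classical.choose_spec ζ.2),
    continuous_ofRootOfUnity _ _ _, Classical.choose ζ.2, ofRootOfUnity_pow _ _ _⟩
  left_inv κ := by
    apply Subtype.ext
    dsimp only
    exact eq_of_eval_one_eq (continuous_ofRootOfUnity _ _ _) κ.2.1
      (ofRootOfUnity_apply_one _ _ _)
  right_inv ζ := by
    apply Subtype.ext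
    dsimp only
    exact ofRootOfUnity_apply_one _ _ _

/-- `finiteOrderCharEquiv` is `ν ↦ ν(1)`. -/
theorem finiteOrderCharEquiv_apply [T2Space R]
    (κ : {κ : AddChar ℤ_[p] R // Continuous κ ∧ ∃ k : ℕ, ∀ x : ℤ_[p], κ x ^ (p ^ k) = 1}) :
    (finiteOrderCharEquiv κ : R) = κ.1 1 := rfl

/-- The same bijection with «finite order» read as «finitely many values»: the continuous
characters of `ℤ_p` with finite range are exactly the p-power roots of unity (T1 + T2 = T2). -/
noncomputable def finiteRangeCharEquiv [T2Space R] :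
    {κ : AddChar ℤ_[p] R // Continuous κ ∧ (Set.range κ).Finite} ≃
      {ζ : R // ∃ k : ℕ, ζ ^ (p ^ k) = 1} where
  toFun κ := ⟨κ.1 1, (exists_pow_eq_one_of_finite_range κ.1 κ.2.1 κ.2.2).imp fun _ h => h 1⟩
  invFun ζ := ⟨ofRootOfUnity ζ.1 (Classical.choose ζ.2) (Classical.choose_spec ζ.2),
    continuous_ofRootOfUnity _ _ _, finite_range_ofRootOfUnity _ _ _⟩
  left_inv κ := by
    apply Subtype.ext
    dsimp only
    exact eq_of_eval_one_eq (continuous_ofRootOfUnity _ _ _) κ.2.1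
      (ofRootOfUnity_apply_one _ _ _)
  right_inv ζ := by
    apply Subtype.ext
    dsimp only
    exact ofRootOfUnity_apply_one _ _ _

/-- `finiteRangeCharEquiv` is `ν ↦ ν(1)`. -/
theorem finiteRangeCharEquiv_apply [T2Space R]
    (κ : {κ : AddChar ℤ_[p] R // Continuous κ ∧ (Set.range κ).Finite}) :
    (finiteRangeCharEquiv κ : R) = κ.1 1 := rfl

/-- Existence form of S5's sentence: for every `ζ` with `ζ^{p^k} = 1` there is a continuous
character `ν` of `ℤ_p` with `ν(1) = ζ` and `ν^{p^k} = 1`, unique among continuous characters. -/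
theorem existsUnique_continuous_addChar_eval_one_eq [T2Space R] (ζ : R) (k : ℕ)
    (hζ : ζ ^ (p ^ k) = 1) :
    ∃! κ : {κ : AddChar ℤ_[p] R // Continuous κ}, κ.1 1 = ζ ∧ ∀ x : ℤ_[p], κ.1 x ^ (p ^ k) = 1 := by
  refine ⟨⟨ofRootOfUnity ζ k hζ, continuous_ofRootOfUnity ζ k hζ⟩,
    ⟨ofRootOfUnity_apply_one ζ k hζ, ofRootOfUnity_pow ζ k hζ⟩, fun κ hκ => ?_⟩
  apply Subtype.ext
  exact eq_of_eval_one_eq κ.2 (continuous_ofRootOfUnity ζ k hζ)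
    (by rw [hκ.1, ofRootOfUnity_apply_one])

end Monoid

section Normed

variable {R : Type*} [NormedRing R] [Algebra ℤ_[p] R] [IsBoundedSMul ℤ_[p] R] [IsUltrametricDist R]

omit [Algebra ℤ_[p] R] [IsBoundedSMul ℤ_[p] R] in
/-- S5, «ν ↦ ζ_ν − 1 is injective»: `κ ↦ κ 1 − 1` is injective on continuous characters of `ℤ_p`
with values in a normed ring. -/
theorem eval_one_sub_one_injective :
    Function.Injective (fun κ : {κ : AddChar ℤ_[p] R // Continuous κ} => κ.1 1 - 1) :=
  sub_left_injective.comp eval_one_injective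

/-- S5, «… into the open disc»: `(κ 1 − 1)^n → 0` for every continuous character `κ`
(Mathlib's `AddChar.tendsto_eval_one_sub_pow`, restated with the cell's names). -/
theorem tendsto_eval_one_sub_one_pow {κ : AddChar ℤ_[p] R} (hκ : Continuous κ) :
    Tendsto (fun n : ℕ => (κ 1 - 1) ^ n) atTop (𝓝 0) :=
  AddChar.tendsto_eval_one_sub_pow hκ

/-- With a multiplicative norm, `‖κ 1 − 1‖ < 1`: the value `ζ_ν = ν(γ₀)` of a continuous character lies
in the open unit disc about `1`. -/
theorem norm_eval_one_sub_one_lt_one [NormMulClass R] {κ : AddChar ℤ_[p] R} (hκ : Continuous κ) :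
    ‖κ 1 - 1‖ < 1 :=
  tendsto_pow_atTop_nhds_zero_iff_norm_lt_one.mp (tendsto_eval_one_sub_one_pow hκ)

/-- p-power roots of unity lie in the open unit disc about `1`: `(ζ − 1)^n → 0` whenever
`ζ^{p^k} = 1` (apply the previous statement to `ofRootOfUnity ζ k hζ`). -/
theorem tendsto_sub_one_pow_of_pow_eq_one (ζ : R) (k : ℕ) (hζ : ζ ^ (p ^ k) = 1) :
    Tendsto (fun n : ℕ => (ζ - 1) ^ n) atTop (𝓝 0) := by
  have h := tendsto_eval_one_sub_one_pow (continuous_ofRootOfUnity ζ k hζ)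
  rwa [ofRootOfUnity_apply_one] at h

/-- `‖ζ − 1‖ < 1` for every p-power root of unity `ζ` of a normed ultrametric `ℤ_p`-algebra with
multiplicative norm: S5's «|ζ − 1| < 1», the hypothesis of p8's T5FiniteZeros. -/
theorem norm_sub_one_lt_one [NormMulClass R] (ζ : R) (k : ℕ) (hζ : ζ ^ (p ^ k) = 1) :
    ‖ζ - 1‖ < 1 :=
  tendsto_pow_atTop_nhds_zero_iff_norm_lt_one.mp (tendsto_sub_one_pow_of_pow_eq_one ζ k hζ)

/-- Mathlib's bijection (`PadicInt.continuousAddCharEquiv_of_norm_mul`) in existence form: for a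
COMPLETE such algebra every `r` with `‖r‖ < 1` is `κ 1 − 1` for exactly one continuous character `κ`. -/
theorem existsUnique_continuous_addChar_eval_one_sub_one_eq [CompleteSpace R] [NormMulClass R]
    (r : R) (hr : ‖r‖ < 1) :
    ∃! κ : {κ : AddChar ℤ_[p] R // Continuous κ}, κ.1 1 - 1 = r := by
  refine ⟨(continuousAddCharEquiv_of_norm_mul p R).symm ⟨r, hr⟩, ?_, fun κ hκ => ?_⟩
  · show ((continuousAddCharEquiv_of_norm_mul p R).symm ⟨r, hr⟩).1 1 - 1 = r
    rw [continuousAddCharEquiv_of_norm_mul_symm_apply, addChar_of_value_at_one_def,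
      add_sub_cancel_left]
  · rcases κ with ⟨κ, hκc⟩
    apply (continuousAddCharEquiv_of_norm_mul p R).injective
    rw [Equiv.apply_symm_apply]
    apply Subtype.ext
    rw [continuousAddCharEquiv_of_norm_mul_apply]
    exact hκ

end Normed

section CommRing

variable {R : Type*} [NormedCommRing R] [Algebra ℤ_[p] R] [IsBoundedSMul ℤ_[p] R]
  [IsUltrametricDist R]

/-- `ζ − 1` is a legitimate evaluation point of power series (`PowerSeries.HasEval`, i.e. topologically
nilpotent) for every p-power root of unity `ζ`: the `HasEval` hypothesis of p8's `finite_aevalZeroSet`. -/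
theorem hasEval_sub_one_of_pow_eq_one (ζ : R) (k : ℕ) (hζ : ζ ^ (p ^ k) = 1) :
    PowerSeries.HasEval (ζ - 1) :=
  tendsto_sub_one_pow_of_pow_eq_one ζ k hζ

/-- `κ 1 − 1` is a legitimate evaluation point of power series for every continuous character `κ`. -/
theorem hasEval_eval_one_sub_one {κ : AddChar ℤ_[p] R} (hκ : Continuous κ) :
    PowerSeries.HasEval (κ 1 - 1) :=
  tendsto_eval_one_sub_one_pow hκ

end CommRing

end Summit.Ventures.HodgeRepro2.T5PadicFiniteOrderCharacters
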